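import Mathlib
import HarnessLib
import Literature.Analysis.FluidPDE.BiotSavartCurlPair
import Literature.Analysis.FluidPDE.HyperbolicDSSOrbit
import Summits.NavierStokesRegularity.NavierStokesRegularity.Theorems.UnthreadedDoorKinematicShadowPointSourceCalculus
import Summits.NavierStokesRegularity.NavierStokesRegularity.Theorems.UnthreadedDoorNetFluxLevelChart
import Summits.NavierStokesRegularity.NavierStokesRegularity.Theorems.UnthreadedDoorKinematicShadowZonalCalculus

/-!
# Route `UnthreadedDoor`, crux `PoloidalLiouville` (stmt-NavierStokesRegularity-1222), WALL W1 — crux idea «kinematic-shadow» (ns-idea-15),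
# zonal sub-rung A_z, Stage 2a: the three COMPONENTS of the steady kinematic law for a ZONAL potential (coordinate-free algebra)

With `y = x − x₀`, `r = ‖y‖`, the zonal coordinate `c = ⟪y,e⟫/r` (unit axis `e`) and its gradient `g = ∇c(x) = r⁻¹e − (⟪y,e⟫r⁻³)y`
(`gradient_zonalCos`, p690412): `g × y = r⁻¹ (e × y)`, `y × (e × y) = r³ g`, `⟪g, e⟫ = (1 − c²)/r`.  Hence, for a zonal potential with
`∇Z(x) = τ • g` and ANY vectors `∇f, ∇m` satisfying the steady kinematic law at `x`, `∇f × y = ∇m × ∇Z` (ns-idea-15's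
`SteadyKinematicLawOn`, `f = ⟪u,∇Z⟫ − ΔZ`, `m = ⟪u, y⟫`): (i) radial component `τ ⟪∇m, e × y⟫ = 0` (the loop momentum is rotation-invariant),
(ii) meridional component `⟪∇f, e × y⟫ = 0`, (iii) azimuthal component `r³ ⟪∇f, g⟫ = −τ (1 − c²) r⁻¹ ⟪∇m, y⟫` — qj-p1's pointwise route to A_z
(NOTE c43a0a2f55ae, steps 1, 2, 4) in coordinate-free form.  Pure algebra; no NS statement; 1222 / W1 / NS regularity OPEN.
`--supports stmt-NavierStokesRegularity-1222 --as helper`.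
-/

noncomputable section

-- the summit and its single sub-problem share the name (CONVENTIONS §1)
set_option linter.dupNamespace false

open Set Function InnerProductSpace
open scoped RealInnerProductSpace

namespace Summit.NavierStokesRegularity.NavierStokesRegularity.Theorems.PoloidalLiouville.KinematicShadow

open Literature.Analysis.FluidPDE
open Summit.NavierStokesRegularity.NavierStokesRegularity.Theorems.PoloidalLiouville.NetFlux (E3)

/-- Lagrange's identity: `⟪a × b, c × d⟫ = ⟪a,c⟫⟪b,d⟫ − ⟪a,d⟫⟪b,c⟫`. [folklore] -/
theorem inner_cross_cross (a b c d : E3) : ⟪cross a b, cross c d⟫ = ⟪a, c⟫ * ⟪b, d⟫ - ⟪a, d⟫ * ⟪b, c⟫ := by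
  simp only [cross, PiLp.inner_apply, RCLike.inner_apply, conj_trivial, Fin.sum_univ_three, cross_apply,
    Matrix.cons_val_zero, Matrix.cons_val_one, Matrix.cons_val_two, Matrix.head_cons, Matrix.tail_cons]
  ring

/-- Bilinearity: `(a • u − b • v) × w = a • (u × w) − b • (v × w)`. [folklore] -/
theorem cross_smul_sub_smul_left (a b : ℝ) (u v w : E3) :
    cross (a • u - b • v) w = a • cross u w - b • cross v w := by
  rw [← crossCLM_apply, ← crossCLM_apply u w, ← crossCLM_apply v w, map_sub, map_smul, map_smul]
  rfl

variable {x₀ x : E3} (e : E3)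

/-- `∇c(x) × y = r⁻¹ (e × y)`. [folklore] -/
theorem cross_gradient_zonalCos (hx : x ≠ x₀) :
    cross (gradient (fun z : E3 => ⟪z - x₀, e⟫ / ‖z - x₀‖) x) (x - x₀) = ‖x - x₀‖⁻¹ • cross e (x - x₀) := by
  rw [gradient_zonalCos e hx, cross_smul_sub_smul_left, PointSource.cross_self, smul_zero, sub_zero]

/-- `y × (e × y) = r³ ∇c(x)` (BAC−CAB). [folklore] -/
theorem cross_self_cross_axis (hx : x ≠ x₀) :
    cross (x - x₀) (cross e (x - x₀)) = (‖x - x₀‖ ^ 3) • gradient (fun z : E3 => ⟪z - x₀, e⟫ / ‖z - x₀‖) x := by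
  have hr : 0 < ‖x - x₀‖ := norm_pos_iff.2 (sub_ne_zero.2 hx)
  rw [cross_cross_right, gradient_zonalCos e hx, real_inner_self_eq_norm_sq, smul_sub (‖x - x₀‖ ^ 3), smul_smul,
    smul_smul]
  have h1 : ‖x - x₀‖ ^ 3 * ‖x - x₀‖⁻¹ = ‖x - x₀‖ ^ 2 := by field_simp
  have h2 : ‖x - x₀‖ ^ 3 * (⟪x - x₀, e⟫ * (‖x - x₀‖ ^ 3)⁻¹) = ⟪x - x₀, e⟫ := by field_simp
  rw [h1, h2]

/-- `⟪∇c(x), e⟫ = (1 − c(x)²)/r` for a unit axis. [folklore] -/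
theorem inner_gradient_zonalCos_axis {e : E3} (he : ‖e‖ = 1) (hx : x ≠ x₀) :
    ⟪gradient (fun z : E3 => ⟪z - x₀, e⟫ / ‖z - x₀‖) x, e⟫ = (1 - (⟪x - x₀, e⟫ / ‖x - x₀‖) ^ 2) / ‖x - x₀‖ := by
  have hr : 0 < ‖x - x₀‖ := norm_pos_iff.2 (sub_ne_zero.2 hx)
  rw [gradient_zonalCos e hx, inner_sub_left, real_inner_smul_left, real_inner_smul_left, real_inner_self_eq_norm_sq, he]
  field_simp

/-- **The three components of the steady kinematic law for a zonal potential (coordinate-free).**  At `x ≠ x₀` let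
`g = ∇c(x)`, `gZ = τ • g` (the gradient of a zonal potential), and let vectors `gf, gm` satisfy the law `gf × y = gm × gZ`.  Then:
(i) `τ ⟪gm, e × y⟫ = 0`; (ii) `⟪gf, e × y⟫ = 0`; (iii) `r³ ⟪gf, g⟫ = −τ · ((1 − c²)/r) · ⟪gm, y⟫` (unit axis `e`). [folklore] -/
theorem zonalLaw_components {e : E3} (he : ‖e‖ = 1) (hx : x ≠ x₀) {τ : ℝ} {gf gm : E3}
    (hlaw : cross gf (x - x₀) = cross gm (τ • gradient (fun z : E3 => ⟪z - x₀, e⟫ / ‖z - x₀‖) x)) :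
    τ * ⟪gm, cross e (x - x₀)⟫ = 0 ∧ ⟪gf, cross e (x - x₀)⟫ = 0 ∧
      ‖x - x₀‖ ^ 3 * ⟪gf, gradient (fun z : E3 => ⟪z - x₀, e⟫ / ‖z - x₀‖) x⟫
        = -τ * ((1 - (⟪x - x₀, e⟫ / ‖x - x₀‖) ^ 2) / ‖x - x₀‖) * ⟪gm, x - x₀⟫ := by
  have hr : 0 < ‖x - x₀‖ := norm_pos_iff.2 (sub_ne_zero.2 hx)
  set g : E3 := gradient (fun z : E3 => ⟪z - x₀, e⟫ / ‖z - x₀‖) x with hg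
  have hgy : cross g (x - x₀) = ‖x - x₀‖⁻¹ • cross e (x - x₀) := cross_gradient_zonalCos e hx
  have hτg : cross (τ • g) (x - x₀) = (τ * ‖x - x₀‖⁻¹) • cross e (x - x₀) := by
    rw [cross_smul_left, hgy, smul_smul]
  refine ⟨?_, ?_, ?_⟩
  · -- (i) inner with `y`
    have h1 : ⟪cross gf (x - x₀), x - x₀⟫ = 0 := by
      rw [NetFlux.inner_cross_left_eq_inner_cross_right, PointSource.cross_self, inner_zero_right]
    rw [hlaw, NetFlux.inner_cross_left_eq_inner_cross_right, hτg, real_inner_smul_right] at h1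
    -- h1 : τ * r⁻¹ * ⟪gm, e × y⟫ = 0
    have h2 : τ * ⟪gm, cross e (x - x₀)⟫ = (τ * ‖x - x₀‖⁻¹ * ⟪gm, cross e (x - x₀)⟫) * ‖x - x₀‖ := by
      field_simp
    rw [h2, h1, zero_mul]
  · -- (ii) inner with `g`
    have h1 : ⟪cross gm (τ • g), g⟫ = 0 := by
      rw [NetFlux.inner_cross_left_eq_inner_cross_right, cross_smul_left, PointSource.cross_self, smul_zero, inner_zero_right]
    rw [← hlaw, NetFlux.inner_cross_left_eq_inner_cross_right] at h1
    -- h1 : ⟪gf, y × g⟫ = 0 ; y × g = -(g × y) = - r⁻¹ (e × y)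
    have h2 : cross (x - x₀) g = -(‖x - x₀‖⁻¹ • cross e (x - x₀)) := by
      rw [← hgy]; exact cross_swap (x - x₀) g
    rw [h2, inner_neg_right, real_inner_smul_right, neg_eq_zero, mul_eq_zero] at h1
    rcases h1 with h1 | h1
    · exact absurd h1 (inv_ne_zero hr.ne')
    · exact h1
  · -- (iii) inner with `e × y`
    have hL : ⟪cross gf (x - x₀), cross e (x - x₀)⟫ = ‖x - x₀‖ ^ 3 * ⟪gf, g⟫ := by
      rw [NetFlux.inner_cross_left_eq_inner_cross_right, cross_self_cross_axis e hx, real_inner_smul_right]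
    have hR : ⟪cross gm (τ • g), cross e (x - x₀)⟫
        = -τ * ((1 - (⟪x - x₀, e⟫ / ‖x - x₀‖) ^ 2) / ‖x - x₀‖) * ⟪gm, x - x₀⟫ := by
      rw [inner_cross_cross, real_inner_smul_left, real_inner_smul_left, hg, inner_gradient_zonalCos_self e hx,
        inner_gradient_zonalCos_axis he hx]
      ring
    rw [← hL, hlaw, hR]

end Summit.NavierStokesRegularity.NavierStokesRegularity.Theorems.PoloidalLiouville.KinematicShadow
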